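import Mathlib
import HarnessLib
import HarnessLib.Audit
import Summits.HodgeConjecture.Statement
import Literature.AlgebraicGeometry.Motives.SummitCompatible
import Literature.AlgebraicGeometry.Motives.Sweep1
import HarnessLib.Audit.Status.Attr

/-!
Route: TorelliForSymmetries

DORMANT since 2026-08-26T20:20:41Z (reconciler: no traction for 5 d (last activity item-evidence-added at 2026-08-21T19:16:42Z); parked, not closed — `ledger route dormant route-HodgeConjecture-TorelliForSymmetries --off` to reactivate) — unstaffed, not closed; items shared with open routes are served there. `ledger route dormant <id> --off` reactivates.

# Route TorelliForSymmetries — Hodge is a Torelli theorem — every involution of the polarized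
ℚ-Hodge structure is a correspondence; hypersurface phantoms first

It suffices to show X = TORELLI FOR SYMMETRIES, global form (card
phantom-automorphisms-torelli-for-symmetries, globalised): for every
smooth projective X/ℂ of dimension n and every degree i, every INVOLUTION of the rational Hodge
structure Hⁱ(X(ℂ),ℚ) is induced by an
algebraic self-correspondence (a class in Aⁿ(X × X) ⊗ ℚ, Kleiman's pairing form) — "the Hodge
structure of a variety has no symmetry that
no cycle on X × X induces". REFLECTION LEMMA (the route's hinge, item ReflectionsDecide, provable
now): for a Hodge class v ∈ Hdgᵖ(X) and an
abstract polarization Q of H²ᵖ(X,ℚ), the Q-reflection s_v(x) = x − 2Q(x,v)/Q(v,v)·v is an involutive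
automorphism of the polarized Hodge
structure; if s_v (or s_{v+ηᵖ}) is a correspondence then, because algebraic correspondences preserve
algebraic classes (Kleiman C-lite),
s(ηᵖ) = ηᵖ − c·v is algebraic with c ≠ 0, so v is algebraic. Hence X ⟹ HC, and HC ⟹ X (the graph of
a Hodge involution is a Hodge class),
so X is HC read as a Torelli principle; Künneth C (grading symmetry) and Lefschetz B (𝔰𝔩₂ Weyl
symmetry) are its degenerate instances.
Stated over a Betti–Hodge realization datum B guarded by comparison-compatibility and a
Künneth–Hodge clause (see Why this line).
Lean: `open Literature.AlgebraicGeometry.Motives CategoryTheory MonoidalCategory in ∀ B :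
BettiHodgeData ℂ, B.IsComparisonCompatible → (∀ ⦃n : ℕ⦄ ⦃X : SchemeOver ℂ⦄ (hX : IsSmoothProjective
n X) (hXX : IsSmoothProjective (n + n) (X ⊗ X)) (i j' : ℕ) (hj : i + j' = 2 * n) (φ :
HodgeStructure.Hom (B.hodge hX i) (B.hodge hX i)), ∃ u ∈ (B.hodge hXX (2 * n)).hodgeClasses (n : ℤ),
B.W.IsInducedBy n n u φ.toLinearMap hj (show i + 2 * n + j' = 2 * (n + n) by omega)) → ∀ ⦃n : ℕ⦄ ⦃X
: SchemeOver ℂ⦄ (hX : IsSmoothProjective n X) (i j' : ℕ) (hj : i + j' = 2 * n) (φ :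
HodgeStructure.Hom (B.hodge hX i) (B.hodge hX i)), φ.toLinearMap ∘ₗ φ.toLinearMap = LinearMap.id → ∃
u ∈ B.W.ratAlgebraicClasses (X ⊗ X) n, B.W.IsInducedBy n n u φ.toLinearMap hj (show i + 2 * n + j' =
2 * (n + n) by omega)`

## Assembly
Pure logic plus the reflection lemma: take B from ClassicalBettiDatum (comparison-compatible +
Künneth–Hodge); for each smooth projective
X, p and a polarization P of H²ᵖ_B(X) (B.polarizable), each reflection s_v in a Hodge class is an
involutive B-Hodge endomorphism
(s_v ∘ s_v = id; it preserves F^• because P(F^a, v) = 0 for a > p and ℚv ⊂ Fᵖ), so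
InvolutionsAreCorrespondences makes it a
correspondence; ReflectionsDecide's argument gives B.HodgeConjectureFor hX p for all X, p; the tree
theorem
`BettiHodgeData.IsComparisonCompatible.forall_hodgeConjectureFor` transfers this to
`HodgeTheory.HodgeConjectureFor n X` for every smooth
projective X, which is `_root_.HodgeConjecture` unfolded. Formal chain (rev 2, gate shape
route.target-unreachable): the support item InvolutionsOfMiddle is the glue
ReflectionsDecide → MiddleInvolutions → InvolutionsAreCorrespondences (DOUBLING Y = X × X: the
Künneth–Hodge graph class u of an
involution φ of Hⁱ_B(X) is a MIDDLE-degree Hodge class on the EVEN-dimensional X × X, smooth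
projective of dimension n + n by the proved
Motives.IsSmoothProjective.tensor_holds; reflections in Hodge classes of H^{2n}_B(X × X) are
involutive B-Hodge endomorphisms, so
MiddleInvolutions makes them correspondences and ReflectionsDecide gives B.HodgeConjectureFor on X ×
X in codimension n, whence
u ∈ ℚ·Aⁿ(X × X) ⊆ Aⁿ(X × X) ⊗ ℚ), and `closes` composes it with Assembly: `fun _ hA _ _ _ hM hD hR
hG => hA hD (hG hR hM)`. The strata
r2 (hypersurfaces, i = n) and r4 (surfaces) are instances of MiddleInvolutions / the target
(Sketch.lean `example`s) and remain
hypotheses of `closes` unused by its proof term: they are the line's research front,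
MiddleInvolutions (rank 5) its honest remainder.

Rationale: WHY THIS LINE. The card isolates PHANTOM symmetries — finite-order Hodge isometries of a
hypersurface induced by no automorphism — and observes that
"Torelli for symmetries" holds exactly where strong Torelli is known (GonzalezaguileraEtAl2022 p. 4
and Thm. C = 5.8: the Punctual Torelli
Principle, proved for Klein hypersurfaces of Wagstaff type; PSS71/BR75 quartic surfaces, CG72/Bea82
cubic threefolds, Voisin/Charles cubic
fourfolds; arXiv:1905.11547 classifies Aut of cubic fourfolds by lattice isometries). The reflection
lemma turns this into a thesis that
DECIDES the summit: HC is the statement that every involution of the polarized ℚ-Hodge structure of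
a smooth projective variety is a
correspondence (VoisinHodgeI2002 Lemma 11.41 and §11.3.3: Hodge morphisms ↔ Hodge classes on X × X,
Id_k and (L^{n−k})⁻¹ of unknown
algebraicity = conjectures C, B; Kleiman1968 §1.3; RamonMari2008 Thm. 3.3 reduces HC for powers of a
CM K3 to Hodge isometries; Buskin2019,
Huybrechts2019: Hodge isometries of K3 surfaces are algebraic). Imported areas: Torelli theory and
lattice isometries (the index set is
the 2-torsion of Aut of a polarized Hodge structure), monodromy / Mumford–Tate theory of families
(CarlsonMullerStachPeters2017 §15.3,
Prop. 15.3.9 = André 1992: algebraic monodromy ◁ generic MT, MT only shrinks at special points) for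
the generic commutant of symmetric
loci (CarlsonToledo1999, AllcockCarlsonToledo2002, DeligneMostow1986 are the model computations),
and Weil-cohomology algebra for the
reduction. No prior route is Torelli- or symmetry-indexed (27 open Hodge routes scanned;
LinearSystemTorelli concerns π₁ of linear
systems); the negatives index is empty. All items are stated for a Betti–Hodge realization B :
BettiHodgeData ℂ guarded by
`B.IsComparisonCompatible` (Hodge classes, algebraic classes, Hodge models agree with the summit
layer; Motives/SummitCompatible) AND a
Künneth–Hodge clause (every B-Hodge endomorphism of Hⁱ_B(X) is induced by a B-Hodge class of type
(n,n) on X × X — true classically, and it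
pins B-Hodge endomorphisms to genuine ones), with the classical instance filed separately as the
construction ClassicalBettiDatum.

RANKED CRUXES. #0 InvolutionsAreCorrespondences (target) — X as in § Thesis: for every guarded B,
every smooth projective X (dim n), every i and every involutive endomorphism φ of the B-Hodge
structure Hⁱ_B(X), some u ∈ Aⁿ(X × X) ⊗ ℚ induces φ (Kleiman pairing form, no condition on other
Künneth components). (why it might fail: It is HC (reflection lemma): it fails iff HC fails;
sharpest candidates are isolated phantom involutions at CM points of general-type hypersurfaces
(card) and Weil-type splittings on A × Eᵖ (Mumford–Weil), which the swap trick turns into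
involutions.) [VoisinHodgeI2002, Kleiman1968, GonzalezaguileraEtAl2022, Schoen1988HodgeWeil]
#2 HypersurfaceInvolutions (crux) — TS(n,d), rational form (card K1–K3 assembled): for every smooth
projective X of dimension n with a closed immersion into P^{n+1} (a hypersurface) and every
involutive endomorphism φ of the B-Hodge structure Hⁿ_B(X), some class in Aⁿ(X × X) ⊗ ℚ induces φ.
Known: (2,4) and every case where the transcendental part is irreducible with h^{n,0} = 1 (σ|_T =
±1, Zarhin-type argument), level one (3,3),(3,4),(5,3) via intermediate Jacobians and Lefschetz
(1,1) on F × F, (4,3) (HC for cubic fourfolds + K3-type T); Fermat points of prime degree are the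
calibration task (Shioda1979HodgeFermat + inductive structure); first open (2,5), (3,5), (4,6).
[difficulty: open-problem] (why it might fail: For even n it contains HC(X) itself via reflections
in middle Hodge classes (open for sextic fourfolds); at CM points Hⁿ splits into many isomorphic
pieces whose swap/sign involutions need cycles nobody has; one isolated phantom pair (X,σ) off every
symmetric and NL locus kills it.) [GonzalezaguileraEtAl2022, arXiv:1905.11547,
Shioda1979HodgeFermat, AokiShioda1983, Buskin2019, Zarhin1983HodgeGroupsK3, VoisinHodgeII2003]
#3 CyclicGenericCommutant (support since retriage gen 2, rank 3 kept; was crux) — Engine (A) of the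
card in its first model case (the card's own fastest-refutation family): for all n ≥ 2, d ≥ 3 there
are a NON-ZERO form G(x₁,…,x_{n+1}) of degree d, a smooth projective n-fold X cut out in ℙ^{n+1} by
the cyclic equation x₀^d + G = 0 (Motives.IsHypersurfaceCutOutBy; for G ≠ 0 smoothness and
irreducibility of X force F = x₀^d + G to be irreducible and nonsingular, so X IS the smooth
degree-d CYCLIC hypersurface — G = 0 is excluded because V₊(x₀^d)_red ≅ ℙⁿ has no transcendental
cohomology and would make the claim vacuous) and an automorphism g of X/ℂ with g^d = 1 (intended:
the deck transformation x₀ ↦ ζ_d·x₀ of the cyclic covering X → ℙⁿ) such that every endomorphism of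
the B-Hodge structure Hⁿ_B(X) acts on the transcendental part (classes cup-orthogonal to all Hodge
classes of Hⁿ; all of Hⁿ for n odd) as a ℚ-polynomial in g* = B.W.pullback g n: the generic
Hodge-endomorphism algebra on the cyclic locus is the image of ℚ[μ_d]. (Rev 1, cone repair: restated
over Motives.Sweep1 instead of SmoothHypersurface.hypersurface / HodgeTheory.diagonalAut, whose
import cone carries the two unproved Stein-factorisation facts; implied by the rev-0 form for
generic G — the diagonal stabiliser of x₀^d + G is then μ_d·scalars and scalars act trivially — and
free of the rev-0 junk witness G = 0.) Equivalent to the very-general form by upper semicontinuity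
of End_HS (MT only shrinks at special points) and implied by Zariski-density of the monodromy of the
cyclic family in the product of the unitary groups of the mixed eigenspaces (André normality).
Consistency checks: (2,3) vacuous (T = 0), (2,4) Kondō's 6-ball (End = ℚ(i); the pure (1,1)
eigenspace x₀·R(G)₃ is algebraic, outside T), (3,3) Allcock–Carlson–Toledo 4-ball (End = ℚ(ω)); for
every other (n,d) each μ_d-eigenspace x₀^j·R(G) of Hⁿ_prim carries ≥ 2 consecutive Hodge types (R(G)
≠ 0 in all degrees 0…(n+1)(d−2), step d ≤ half the range), so every unitary factor is indefinite and
no eigen-orbit is of CM/definite type — no extra generic endomorphism is forced by Hodge numbers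
alone. [difficulty: L] (why it might fail: A mixed μ_d-eigenspace may carry small monodromy (finite,
or the unitary group of a hidden sub-form — Deligne–Mostow/ACT-type uniformisations), or two
eigen-orbits may be generically Hodge-isomorphic; either yields generic endomorphisms outside ℚ[μ_d]
for some (n,d).) [CarlsonToledo1999, AllcockCarlsonToledo2002, DeligneMostow1986,
CarlsonMullerStachPeters2017, VoisinHodgeII2003]
#4 SurfaceInvolutions (crux) — The first open stratum of X by dimension: for every smooth projective
surface S and every involutive endomorphism φ of the B-Hodge structure H²_B(S), some class in A²(S ×
S) ⊗ ℚ induces φ. By Lefschetz (1,1) and Künneth on NS ⊗ NS this is automatic for p_g ≤ 1 (T(S)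
irreducible, Zarhin) and for p_g ≥ 2 it says exactly: the projectors of every splitting T(S)_ℚ = T₁
⊕ T₂ of the transcendental cohomology into Hodge substructures are algebraic on S × S (geometric
splittings — automorphisms, fibrations, K3/abelian covers — are; CM/accidental splittings are the
content; quintic surfaces are the hypersurface case (2,5)). [difficulty: open-problem] (why it might
fail: A surface with p_g ≥ 2 whose transcendental lattice splits for arithmetic (CM by an étale
algebra) rather than geometric reasons gives a projector on S × S outside every known cycle supply
(Schoen-type Weil classes reappear on self-products of cyclic covers).) [RamonMari2008,
Schoen1988HodgeWeil, Zarhin1983HodgeGroupsK3, Buskin2019, Huybrechts2019, Moonen2017TateMTh20one]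
#5 MiddleInvolutions (crux) — THE COMPLEMENTARY SECTOR, one catch-all crux ranked last and
deliberately not split (obligation-graph rule: the sector the strata r2/r4 leave open is LISTED AS A
CRUX, never hidden in glue): for every guarded B, every smooth projective Y of EVEN dimension n + n
and every involutive endomorphism φ of the B-Hodge structure on the MIDDLE cohomology H^{2n}_B(Y),
some class in A^{2n}(Y × Y) ⊗ ℚ induces φ (pairing form, for all j' with 2n + j' = 2(n + n) —
verbatim the shape of ReflectionsDecide's hypothesis at (Y, p = n)). Universal by DOUBLING, not by
BFNP: the graph class of any Hodge endomorphism of any Hⁱ_B(X) is a middle-degree Hodge class on the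
even-dimensional X × X, so with ReflectionsDecide it yields the target (glue InvolutionsOfMiddle)
and hence HC — no Bertini, weak Lefschetz or ℙʳ-products (BrosnanFangNiePearlstein2009 Lemma 48 =
HodgeTheory.middleDimensionReduction, whose tree discharge still rests on three root facts, stays
OUT of this route's cone); conversely HC(Y × Y, n + n) implies it. SurfaceInvolutions is its n = 1
stratum, HypersurfaceInvolutions (even n) its hypersurface stratum. [difficulty: open-problem] (why
it might fail: It is all of HC: fails iff HC fails anywhere; sharpest middle-degree candidates are
Weil classes on abelian fourfolds/sixfolds read as swap involutions (MoonenZarhin1999;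
Markman2025SurveySecant settles the Weil type only), Schoen-type classes on self-products of cyclic
covers, CM splittings of general-type surfaces.) [VoisinHodgeI2002, BrosnanFangNiePearlstein2009,
MoonenZarhin1999, Weil1977HodgeRing, Markman2025SurveySecant, Shioda1983WhatIsKnown]
#9 ClassicalBettiDatum (support) — CONSTRUCTION (interface + construction pattern; no existence is
smuggled into the guarded items): there is a Betti–Hodge realization datum B (singular cohomology of
X(ℂ) with ℚ-coefficients as a Weil cohomology, Hodge–Deligne structures, cycle classes) which is
comparison-compatible with the summit layer and satisfies the Künneth–Hodge clause (the Künneth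
class of a Hodge endomorphism is a Hodge class on X × X, VoisinHodgeI2002 Lemma 11.41). Shared in
substance with ConservativityLefschetz.ClassicalBettiDatum / MomentAmplification.BettiBridge
(cocycle-level guard; equivalent by Motives/SummitCompatibleIff). [difficulty: XL] [Kleiman1968,
VoisinHodgeI2002, Deligne2000]
#9 ReflectionsDecide (support) — THE REFLECTION LEMMA (new, elementary, provable now from the fields
of WeilCohomology/BettiHodgeData and the tree's HodgeStructure.Polarization): for ANY B, X smooth
projective of dimension n, p, and any polarization P of the B-Hodge structure H²ᵖ_B(X): if for every
Hodge class v the P-reflection x ↦ x − (2/P(v,v))·P(x,v)·v is induced on H²ᵖ by some class in Aⁿ(X ×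
X) ⊗ ℚ, then Hdgᵖ_B(X) = ℚ·Aᵖ_B(X). Proof: P(v,v) > 0 (Hodge–Riemann, Polarization.pos on the
(p,p)-piece); ηᵖ (hyperplane power) is algebraic and non-zero for p ≤ n (trace ηⁿ = deg > 0), H²ᵖ =
0 for p > n; correspondences preserve rational algebraic classes
(map_ratAlgebraicClasses_of_isInducedBy), so s_v(ηᵖ) = ηᵖ − (2P(ηᵖ,v)/P(v,v))v is algebraic; if
P(ηᵖ,v) ≠ 0 done, else replace v by v + ηᵖ (P(ηᵖ, v+ηᵖ) = P(ηᵖ,ηᵖ) > 0). [difficulty: provable-now]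
[Kleiman1968, VoisinHodgeI2002, BrosnanFangNiePearlstein2009]
#9 InvolutionsOfMiddle (support) — GLUE concluding the target (rev 2): ReflectionsDecide →
MiddleInvolutions → InvolutionsAreCorrespondences. Proof (provable now, M-sized Lean): given B
guarded with Künneth–Hodge clause K, X of dimension n and an involution φ of Hⁱ_B(X), K gives a
Hodge class u ∈ Hdgⁿ_B(X × X) inducing φ; X × X is smooth projective of dimension n + n
(Motives.IsSmoothProjective.tensor_holds, proved) and H^{2n} is its middle degree; B.polarizable
gives a polarization P of H^{2n}_B(X × X); for every Hodge class v there the P-reflection s_v = id −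
(2/P(v,v))·P(·,v)·v is a B-Hodge endomorphism (map_F_le: P(F^a, v) = 0 for a > n by the first
Hodge–Riemann relation form_apply_eq_zero, and ℚv ⊆ Fⁿ ⊆ F^a for a ≤ n) with s_v ∘ s_v = id
identically (also in the junk case P(v,v) = 0, where s_v = id); MiddleInvolutions at Y = X × X makes
each s_v a correspondence on (X × X) × (X × X), ReflectionsDecide yields B.HodgeConjectureFor hXX n,
i.e. Hdgⁿ_B(X × X) = ℚ·Aⁿ_B(X × X), and ℚ·Aⁿ ⊆ Aⁿ ⊗ ℚ (algebraicLattice_le_ratAlgebraicClasses +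
ratCast_smul_mem_ratAlgebraicClasses), so u is the wanted rational algebraic class. [deps:
ReflectionsDecide, MiddleInvolutions] [difficulty: M] [Kleiman1968, VoisinHodgeI2002]

TWO-LAYER PLAN. Foreseen split of HypersurfaceInvolutions (the card's K1–K3; nothing filed now):
HypersurfaceInvolutions ⇐ SymmetricBigMonodromy (K1: for
every finite G ⊂ PGL_{n+2} the generic Hodge-endomorphism algebra of Hⁿ_prim on the G-symmetric
locus Z_G is the image of ℚ[G];
CyclicGenericCommutant is its model case) → PhantomLociAreExpected (K2: every positive-dimensional
component of the Hodge locus of the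
class of an involution σ in the universal family is an automorphism locus or a Noether–Lefschetz
locus along which σ is benign — BKU
finiteness of maximal atypical loci, CDK algebraicity, KOU fields of definition) → IsolatedCensus
(K3: the finite list of rigid pairs
(X,σ) for (2,5),(3,5),(4,6) by conjugacy classes of involutions of the polarized lattice minus
realisable automorphism types
(GonzalezaguileraEtAl2022 §3, arXiv:1905.11547), each decided by IVHS rank / certified periods) →
HypersurfaceInvolutions, glue =
"benign ⟹ correspondence" (graphs of automorphisms and reflections in algebraic classes are
algebraic). Foreseen supports: the
Jacobian-ring asymmetry lemma (an involution compatible with the full IVHS multiplication R_d ⊗ R_t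
→ R_{t+d} is ± an automorphism:
Donagi symmetriser + Mather–Yau; it makes isolated phantoms IVHS-asymmetric), the Fermat calibration
(TS for Fermat hypersurfaces of prime
degree from Shioda1979HodgeFermat + Shioda–Katsura inductive structure), the level-one calibration
(cubic threefolds through the Fano
surface of lines). Foreseen split of SurfaceInvolutions: geometric splittings (automorphism /
fibration / K3-or-abelian cover: provable)
+ CM splittings (T of CM type by an étale algebra; RamonMari2008-type Tannakian arguments) + the
rest. MiddleInvolutions: no split foreseen
(catch-all; a split by dimension or Kodaira class would be bookkeeping, not mathematics).

KILL CRITERIA. (i) A smooth hypersurface X over ℚ̄ with an involutive Hodge endomorphism σ of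
Hⁿ(X,ℚ) whose inducing class is shown non-algebraic closes
the route refuted:HypersurfaceInvolutions — and refutes HC itself, so in practice the refuting
evidence is an ISOLATED point of the Hodge
locus of graph(σ) with certified transcendental coordinates (HC ⟹ absolute Hodge ⟹ ℚ̄,
Voisin2007HodgeLoci); such a certificate hands the
pair to the negative routes (SecondaryPeriods-type) and closes this one. (ii) CyclicGenericCommutant
refuted at some (n,d) (generic extra
endomorphisms on the cyclic locus) does NOT close the route: restate once with the true generic
commutant (the extra endomorphisms are
then themselves involution candidates to explain); a second refutation of the restated engine
retires engine (A) and the route pivots to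
the isolated-census line only. (iii) ReflectionsDecide or Assembly refuted AS STATED = misstatement
(degree bookkeeping / guard): repair
by restating, never a close. (iv) Mooted if AnchorTransport / LinearSystemTorelli prove variational
HC (then every positive-dimensional
phantom locus through a benign point is settled and only isolated phantoms remain — merge into their
census). (v) MiddleInvolutions refuted is
¬HC outright (a non-algebraic middle-degree Hodge involution on some even-dimensional Y, e.g. a
certified non-algebraic Weil class read as a swap
involution): the summit is then decided negatively and every HC route closes with this one;
InvolutionsOfMiddle refuted AS STATED = misstatement
(index bookkeeping n + n vs 2n), repaired by restating, never a close.

NOT DECOMPOSED YET. The target beyond hypersurfaces (i = n) and surfaces is, by the reflection lemma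
and the doubling Y = X × X, all of HC; since rev 2
(gate shape route.target-unreachable, 2026-08-16) it is itemised as ONE catch-all crux
MiddleInvolutions (rank 5) plus the provable glue
InvolutionsOfMiddle, and deliberately NOT split further — no engine of this line reaches past the
hypersurface and surface strata. The degenerate instances Künneth C (σ = grading) and Lefschetz B
(𝔰𝔩₂ Weyl element) are shared
with MomentAmplification.LefschetzB / PeriodsPolice.LefschetzB and not re-filed. K1 for general
finite G, K2, K3, the Jacobian-ring lemma
and the calibrations (Two-layer plan) wait for r2/r3 to move. Integral refinements (the card's
torsion of the INTEGRAL isometry group,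
where strong Torelli calibrates) index candidates but are not items: everything filed is ℚ-linear.
The refutation branch (transcendence of
an isolated phantom point) belongs to the negative routes and the card
two-attractor-transcendence-test.

CHEAPEST FALSIFIER. Jacobian-ring IVHS check of CyclicGenericCommutant at (n,d) = (2,5): for X_G :
x₀⁵ + G(x₁,x₂,x₃) = 0 the μ₅-eigenspaces of H²_prim have
Hodge numbers (h^{2,0},h^{1,1},h^{0,2}) = (3,10,0), (1,12,0), (0,12,1), (0,10,3) (pieces x₀^j·R_G in
degrees 1−j, 6−j, 11−j of the
Jacobian ring of the plane quintic G; total 52 = b₂ − 1); compute for one random G the infinitesimal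
period maps R_5(G) → Hom(H^{2,0}_χ,
H^{1,1}_χ) per character: if some χ-component has rank forcing a generic splitting of V_χ (a proper
sub-VHS), r3 fails at (2,5) and the
extra generic endomorphism is a concrete phantom candidate; if all components are of maximal rank
the engine survives its first test. A
finite linear-algebra computation (kit, minutes); not run here (this seat has no compute payload).
Second cheapest: reduce one X_G/ℚ mod two
primes and read End from Frobenius characteristic polynomials (Terasoma/van Geemen method) — a
positive certificate of the ∃-form of r3 at (2,5).

NUMBERS. Quintic surfaces: 40 moduli, h^{2,0} = 4, b₂ = 53, period-domain dimension 182 (card);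
cyclic quintic surfaces x₀⁵ + G: 12 moduli (plane
quintics), eigenspace Hodge numbers as above, the χ-piece with h^{2,0} = 1 is a 12-ball quotient
candidate. Punctual Torelli known:
Klein–Wagstaff hypersurfaces with d | n+3 or d = 3, n ≥ 5 (GonzalezaguileraEtAl2022 Thm. C); strong
Torelli: (2,4), (3,3), (4,3); rational
generic Torelli: Voisin 2022 (all but finitely many (n,d)). Eigenspace purity (hence exclusion from
the transcendental part) occurs on the
cyclic locus only for (n,d) = (2,3) (all of H²_prim) and (2,4) (the (−1)-eigenspace, 7 classes); for
n ≥ 3 or d ≥ 5 every non-empty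
eigenspace is of mixed type (arithmetic-progression count in the Jacobian ring, this folder's
NOTES.md).

DEFINITION REQUESTS. None needed to state the items (all nine elaborate: folder Sketch.lean rc 0
incl. the rev-2 `closes`; rev 2 adds MiddleInvolutions +
InvolutionsOfMiddle over the same two imports, and Motives.IsSmoothProjective.tensor_holds
(SegreEmbedding, proved) enters only the glue's PROOF; rev 1: the whole route namespace incl.
`closes` re-elaborates with imports Motives.SummitCompatible + Motives.Sweep1 only —
HodgeTheory.DiagonalSymmetry dropped, so the import cone no longer reaches
Morphisms.SteinFactorization and carries no unproved named fact). Wanted later as Literature facts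
for the
proof side of r3: André 1992 Thm 1 (algebraic monodromy normal in the generic Mumford–Tate group;
CarlsonMullerStachPeters2017 Prop. 15.3.9)
and a Zariski-density theorem for the monodromy of cyclic covers of Pⁿ branched along hypersurfaces
(CarlsonToledo1999; exact theorem
number to be pinned by the grounder — searchd was unavailable to this seat).

Novelty: Searches (2026-08-15): `lit vsearch` ×3 (no_graph; "HC equivalent to automorphisms of Hodge
structure induced by algebraic cycles" → VoisinHodgeI2002 pp. 235–237 read; "monodromy cyclic covers
Zariski dense unitary" → CarlsonMullerStachPeters2017 pp. 376–377 read; papers index empty), `lit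
read arxiv:2212.13308` (pp. 1, 4 read: PTP), `lit read arxiv:math/0505357` (RamonMari2008, grep Thm
3.3/3.4), `lit read` Schoen 1988 Compositio (numdam, pp. 2–3), `lit search` ×4 rc 75 (searchd
unavailable: the zbMATH/OpenAlex query "automorphisms of Hodge structures algebraic correspondence
equivalent Hodge conjecture" is OWED — first thing for the novelty audit), `lit galaxy search --star
all` ×3 (0 rows: "punctual Torelli", "Torelli principle", "monodromy of cyclic coverings"), `ledger
negatives` (0), digest routes.json (27 open Hodge routes' theses scanned: none
symmetry/Torelli-indexed), the card + its triage note.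
Nearest prior art found: VoisinHodgeI2002 Lemma 11.41 / §11.3.3 (Hom-form of HC; Id_k and
(L^{n−k})⁻¹ as Hodge morphisms of unknown algebraicity); GonzalezaguileraEtAl2022 (Punctual Torelli
Principle for Klein hypersurfaces, and the remark that NL splittings give non-geometric
involutions); RamonMari2008 Thm 3.3 (HC for powers of a CM K3 reduced to Hodge ISOMETRIES by
norm-one generation); Buskin2019 / Huybrechts2019 (Hodge isometries of K3 are algebraic);
Schoen1988HodgeWeil (automorphism-representation supply of Hodge classes on self-products);
Kleiman1968 (C and B as alge  [refs: 2212.13308, math/0505357, arxiv:2212.13308, arxiv:math/0505357, VoisinHodgeI2002, CarlsonMullerStachPeters2017, RamonMari2008, GonzalezaguileraEtAl2022, Buskin2019, Huybrechts2019, Kleiman1968]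

Barriers (technique_class: hodge-isometries, torelli, monodromy, correspondences): - technique_class: hodge-isometries, torelli, monodromy, correspondences
- Literature.Barriers.HodgeConjecture.Andre1996_hodgeClassesOnAbelianVarieties_motivated: not leaned
on — the arena includes general type (quintic surfaces, d > n+2: h^{2,0} = 4, no Kuga–Satake, not of
abelian type) and the reflection lemma is motive-free; where the line meets abelian type (K3, cubic
fourfolds) it records KNOWN cases only.
- Literature.Barriers.HodgeConjecture.Mumford1968_simpleFourfold_exceptionalHodgeClasses: it does
not evade it; the bet is the opposite bookkeeping — the line never claims Hodge classes are
generated by divisors or intersections (likewise the catalogue file's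
Weil1977_exceptionalHodgeClasses); exceptional (Weil-type) classes reappear as graph-type classes of
involutions (swap trick on A × Eᵖ, Schoen-type classes on self-products of cyclic covers) and are
exactly what the target must explain, indexed by the 2-torsion of Aut of the polarized Hodge
structure instead of by degree.
- Literature.Barriers.HodgeConjecture.CattaniDeligneKaplan1995_hodgeLocus_algebraicFor: used
positively in the two-layer plan (phantom loci = Hodge loci of graph classes are algebraic, finitely
many components per level), never contradicted; the zero-dimensional components, where CDK says
nothing about fields of definition, are handed to the negative routes. (The catalogue's
Voisin2003_generalHypersurface_noIntegralClassInF is likewise consistent: CyclicGenericCommutant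
says the GENERIC member of

Novelty grade: new-combination — route-review grade (refuter-rreview-0815T16-4-0). Layer 1 (target InvolutionsAreCorrespondences) is a REFORMULATION of HC: Hom-form HC (Voisin I 11.3.3) restricted to order-2 elements, the elementary reflection trick (item ReflectionsDecide) showing nothing is lost — the same generation-by-isometrie (refuter refuter-rreview-0815T16-4-0, 2026-08-15T17:36:12Z; prior: VoisinHodgeI2002 sec 11.3.3 / Lemma 11.41 (Hom-form of HC), Kleiman1968 sec 1.3 (correspondences; B/C as algebraicity of canonical Hodge involutions), arXiv:math/0505357 (Ramon-Mari Thm 3.3: HC for CM K3 powers reduced to Hodge isometries), Buskin2019 / Huybrechts2019 (Hodge isometries of K3 algebraic), arXiv:2212.13308 (GALM, Torelli principle for automorphisms of Klein hypersurfaces), arXiv:1905)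

History (route lifecycle, newest last):
- 2026-08-15T16:59:27Z · rev 1: restated CyclicGenericCommutant (stmt-HodgeConjecture-11025) — cone repair (route-repair seat): CyclicGenericCommutant restated over Motives.Sweep1 (IsHypersurfaceCutOutBy + abstract order-d automorphism g, G ≠ 0) instead o (planner-rrepair-HodgeConjecture-TorelliForSymm-50d00476-0)
- 2026-08-16T03:33:49Z · rev 6: dropped HigherMiddleInvolutions, TargetGlue — route-choice seat: withdraw my duplicate pair HigherMiddleInvolutions (14466) + TargetGlue (14467) — the parallel rbadge seat landed the same square/doubling-tr (planner-rchoice-HodgeConjecture-TorelliForSymm-18132557-0)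
- 2026-08-16T04:01:00Z · AUTO-CRUX (edit): InvolutionsAreCorrespondences — hypotheses of the deciding theorem that nothing in the route derives are cruxes (planner-rchoice-HodgeConjecture-TorelliForSymm-18132557-0)
- 2026-08-26T20:20:41Z · DORMANT — reconciler: no traction for 5 d (last activity item-evidence-added at 2026-08-21T19:16:42Z); parked, not closed — `ledger route dormant route-HodgeConjecture-To (operator:999:2207339)

sub-problem: HodgeConjecture · status: dormant · opened planner-plancard-HodgeConjecture-HodgeConject-f5d395ef-0 2026-08-15T16:41:32Z · rev 6 · ledger route-HodgeConjecture-TorelliForSymmetries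
GENERATED by the gate from the ledger (D-0016/17). Provers cite these decls: `theorem foo : Summit.HodgeConjecture.HodgeConjecture.Theses.TorelliForSymmetries.<Decl> := …` in Summits/HodgeConjecture/HodgeConjecture/Theorems/<Name>.lean.
-/

namespace Summit.HodgeConjecture.HodgeConjecture.Theses.TorelliForSymmetries

open scoped BigOperators Topology Manifold Classical MeasureTheory ProbabilityTheory Matrix InnerProductSpace ComplexConjugate ContinuousMap
open Filter Set Function TopologicalSpace MeasureTheory

attribute [summit_statement] _root_.HodgeConjecture

/-- item stmt-HodgeConjecture-11023 · crux (kind.auto-crux: conjecture-grade) · rank 0 · open · by planner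
why it might fail: It is HC (reflection lemma): fails iff HC fails. Trivial where Hdg^⊥ is irreducible (involutions of a division algebra are ±1), so the content is reducible transcendental parts + HC(X): isolated phantom involutions at CM points of general-type hypersurfaces; Weil-type splittings.
sources: VoisinHodgeI2002, Kleiman1968, GonzalezaguileraEtAl2022, Schoen1988HodgeWeil
[target] X as in § Thesis: for every guarded B, every smooth projective X (dim n), every i and every
involutive endomorphism φ of the B-Hodge structure Hⁱ_B(X), some u ∈ Aⁿ(X × X) ⊗ ℚ induces φ
(Kleiman pairing form, no condition on other Künneth components). -/
@[route_item "route-HodgeConjecture-TorelliForSymmetries", crux]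
def InvolutionsAreCorrespondences : Prop :=
  open Literature.AlgebraicGeometry.Motives CategoryTheory MonoidalCategory in ∀ B : BettiHodgeData ℂ, B.IsComparisonCompatible → (∀ ⦃n : ℕ⦄ ⦃X : SchemeOver ℂ⦄ (hX : IsSmoothProjective n X) (hXX : IsSmoothProjective (n + n) (X ⊗ X)) (i j' : ℕ) (hj : i + j' = 2 * n) (φ : HodgeStructure.Hom (B.hodge hX i) (B.hodge hX i)), ∃ u ∈ (B.hodge hXX (2 * n)).hodgeClasses (n : ℤ), B.W.IsInducedBy n n u φ.toLinearMap hj (show i + 2 * n + j' = 2 * (n + n) by omega)) → ∀ ⦃n : ℕ⦄ ⦃X : SchemeOver ℂ⦄ (hX : IsSmoothProjective n X) (i j' : ℕ) (hj : i + j' = 2 * n) (φ : HodgeStructure.Hom (B.hodge hX i) (B.hodge hX i)), φ.toLinearMap ∘ₗ φ.toLinearMap = LinearMap.id → ∃ u ∈ B.W.ratAlgebraicClasses (X ⊗ X) n, B.W.IsInducedBy n n u φ.toLinearMap hj (show i + 2 * n + j' = 2 * (n + n) by omega)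

/-- item stmt-HodgeConjecture-11024 · crux · rank 2 · open · by planner
why it might fail: Trivial for very general X (End=ℚ); for even n it contains middle-degree HC(X) via reflections, open from sextic 4-folds on (ConteMurre1978: d≤5); at Fermat points of composite d, swaps of isomorphic character pieces are Aoki–Shioda-type classes of unknown algebraicity; one rigid phantom refutes it.
sources: GonzalezaguileraEtAl2022, ConteMurre1978, Zucker1977, Shioda1979HodgeFermat, AokiShioda1983, Zarhin1983HodgeGroupsK3
[crux] TS(n,d), rational form (card K1–K3 assembled): for every smooth projective X of dimension n
with a closed immersion into P^{n+1} (a hypersurface) and every involutive endomorphism φ of the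
B-Hodge structure Hⁿ_B(X), some class in Aⁿ(X × X) ⊗ ℚ induces φ. Known: (2,4) and every case where
the transcendental part is irreducible with h^{n,0} = 1 (σ|_T = ±1, Zarhin-type argument), level one
(3,3),(3,4),(5,3) via intermediate Jacobians and Lefschetz (1,1) on F × F, (4,3) (HC for cubic
fourfolds + K3-type T); Fermat points of prime degree are the calibration task
(Shioda1979HodgeFermat + inductive structure); first open (2,5), (3,5), (4,6). [difficulty:
open-problem] -/
@[route_item "route-HodgeConjecture-TorelliForSymmetries", crux]
def HypersurfaceInvolutions : Prop :=
  open Literature.AlgebraicGeometry.Motives CategoryTheory MonoidalCategory in ∀ B : BettiHodgeData ℂ, B.IsComparisonCompatible → (∀ ⦃n : ℕ⦄ ⦃X : SchemeOver ℂ⦄ (hX : IsSmoothProjective n X) (hXX : IsSmoothProjective (n + n) (X ⊗ X)) (i j' : ℕ) (hj : i + j' = 2 * n) (φ : HodgeStructure.Hom (B.hodge hX i) (B.hodge hX i)), ∃ u ∈ (B.hodge hXX (2 * n)).hodgeClasses (n : ℤ), B.W.IsInducedBy n n u φ.toLinearMap hj (show i + 2 * n + j' = 2 * (n + n) by omega))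 → ∀ ⦃n : ℕ⦄ ⦃X : SchemeOver ℂ⦄ (hX : IsSmoothProjective n X) (e : ProjectiveEmbedding X), e.n = n + 1 → ∀ φ : HodgeStructure.Hom (B.hodge hX n) (B.hodge hX n), φ.toLinearMap ∘ₗ φ.toLinearMap = LinearMap.id → ∃ u ∈ B.W.ratAlgebraicClasses (X ⊗ X) n, B.W.IsInducedBy n n u φ.toLinearMap (show n + n = 2 * n by omega) (show n + 2 * n + n = 2 * (n + n) by omega)

/-- item stmt-HodgeConjecture-11026 · crux · rank 4 · open · by planner
why it might fail: Automatic if T(S) is irreducible (p_g≤1); for p_g≥2 it needs on S×S the projectors of EVERY splitting T(S)_ℚ=T₁⊕T₂ and swaps T₁≅T₂ of K3-type summands (Buskin2019/Huybrechts2019: only isometries of genuine K3s); a CM splitting of a general-type surface lies outside every known cycle supply.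
sources: RamonMari2008, Buskin2019, Huybrechts2019, Zarhin1983HodgeGroupsK3, Moonen2017TateMTh20one, Schoen1988HodgeWeil
[crux] The first open stratum of X by dimension: for every smooth projective surface S and every
involutive endomorphism φ of the B-Hodge structure H²_B(S), some class in A²(S × S) ⊗ ℚ induces φ.
By Lefschetz (1,1) and Künneth on NS ⊗ NS this is automatic for p_g ≤ 1 (T(S) irreducible, Zarhin)
and for p_g ≥ 2 it says exactly: the projectors of every splitting T(S)_ℚ = T₁ ⊕ T₂ of the
transcendental cohomology into Hodge substructures are algebraic on S × S (geometric splittings —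
automorphisms, fibrations, K3/abelian covers — are; CM/accidental splittings are the content;
quintic surfaces are the hypersurface case (2,5)). [difficulty: open-problem] -/
@[route_item "route-HodgeConjecture-TorelliForSymmetries", crux]
def SurfaceInvolutions : Prop :=
  open Literature.AlgebraicGeometry.Motives CategoryTheory MonoidalCategory in ∀ B : BettiHodgeData ℂ, B.IsComparisonCompatible → (∀ ⦃n : ℕ⦄ ⦃X : SchemeOver ℂ⦄ (hX : IsSmoothProjective n X) (hXX : IsSmoothProjective (n + n) (X ⊗ X)) (i j' : ℕ) (hj : i + j' = 2 * n) (φ : HodgeStructure.Hom (B.hodge hX i) (B.hodge hX i)), ∃ u ∈ (B.hodge hXX (2 * n)).hodgeClasses (n : ℤ), B.W.IsInducedBy n n u φ.toLinearMap hj (show i + 2 * n + j' = 2 * (n + n) by omega)) → ∀ ⦃X : SchemeOver ℂ⦄ (hX : IsSmoothProjective 2 X) (φ : HodgeStructure.Hom (B.hodge hX 2) (B.hodge hX 2)), φ.toLinearMap ∘ₗ φ.toLinearMap = LinearMap.id → ∃ u ∈ B.W.ratAlgebraicClasses (X ⊗ X) 2, B.W.IsInducedBy 2 2 u φ.toLinearMap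 (show 2 + 2 = 2 * 2 by omega) (show 2 + 2 * 2 + 2 = 2 * (2 + 2) by omega)

/-- item stmt-HodgeConjecture-14418 · crux · rank 5 · open · by planner
why it might fail: It is all of HC (doubling Y = X×X + reflections): fails iff HC fails anywhere; sharpest middle-degree candidates: Weil classes on abelian 4- /6-folds as swap involutions (MoonenZarhin1999; Markman settles Weil type only), Schoen classes on self-products, CM splittings of general-type surfaces.
sources: VoisinHodgeI2002, BrosnanFangNiePearlstein2009, MoonenZarhin1999, Weil1977HodgeRing, Markman2025SurveySecant, Shioda1983WhatIsKnown
[crux] THE COMPLEMENTARY SECTOR — one catch-all crux, ranked last, deliberately not split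
(obligation-graph rule: the sector the strata HypersurfaceInvolutions / SurfaceInvolutions leave
open is LISTED AS A CRUX, never hidden in glue): for every guarded B (comparison-compatible +
Künneth–Hodge clause), every smooth projective Y of EVEN dimension n + n and every involutive
endomorphism φ of the B-Hodge structure on the MIDDLE cohomology H^{2n}_B(Y), some class in A^{2n}(Y
× Y) ⊗ ℚ induces φ (Kleiman pairing form; stated for all j' with 2n + j' = 2(n + n), verbatim the
shape of ReflectionsDecide's hypothesis at (Y, p = n)). Universal by DOUBLING: the Künneth–Hodge
graph class of ANY Hodge endomorphism of ANY Hⁱ_B(X) is a middle-degree Hodge class on the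
even-dimensional X × X, so together with ReflectionsDecide this item implies the target (glue
InvolutionsOfMiddle) and hence HC — without Bertini, weak Lefschetz or ℙʳ-products (contrast
BrosnanFangNiePearlstein2009 Lemma 48 = HodgeTheory.middleDimensionReduction, whose tree discharge
still rests on three root facts and is kept OUT of this route's cone); conversely HC(Y × Y, codim n
+ n) implies it, so it is HC-complete. SurfaceInvolu -/
@[route_item "route-HodgeConjecture-TorelliForSymmetries", crux]
def MiddleInvolutions : Prop :=
  open Literature.AlgebraicGeometry.Motives CategoryTheory MonoidalCategory in ∀ B : BettiHodgeData ℂ, B.IsComparisonCompatible → (∀ ⦃n : ℕ⦄ ⦃X : SchemeOver ℂ⦄ (hX : IsSmoothProjective n X) (hXX : IsSmoothProjective (n + n) (X ⊗ X)) (i j' : ℕ) (hj : i + j' = 2 * n) (φ : HodgeStructure.Hom (B.hodge hX i) (B.hodge hX i)), ∃ u ∈ (B.hodge hXX (2 * n)).hodgeClasses (n : ℤ), B.W.IsInducedBy n n u φ.toLinearMap hj (show i + 2 * n + j' = 2 * (n + n) by omega)) → ∀ ⦃n : ℕ⦄ ⦃Y : SchemeOver ℂ⦄ (hY : IsSmoothProjective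 (n + n) Y) (φ : HodgeStructure.Hom (B.hodge hY (2 * n)) (B.hodge hY (2 * n))), φ.toLinearMap ∘ₗ φ.toLinearMap = LinearMap.id → ∀ (j' : ℕ) (hj : 2 * n + j' = 2 * (n + n)), ∃ u ∈ B.W.ratAlgebraicClasses (Y ⊗ Y) (n + n), B.W.IsInducedBy (n + n) (n + n) u φ.toLinearMap hj (show 2 * n + 2 * (n + n) + j' = 2 * ((n + n) + (n + n)) by omega)

-- earlier CyclicGenericCommutant (stmt-HodgeConjecture-11025, replaced 2026-08-15T16:59:27Z -> stmt-HodgeConjecture-11279): retired by None — open Literature.AlgebraicGeometry.Motives CategoryTheory MonoidalCategory in ∀ B : BettiHodgeData ℂ, B.IsComparisonCompatible → (∀ ⦃n : ℕ⦄ ⦃X : SchemeOver ℂ⦄ (hX : IsSmoothProjective n X) (hXX : IsSmoothProjective (n + n) (X ⊗ X)) (i j' : ℕ) (hj : i + j' = 2 *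
/-- item stmt-HodgeConjecture-11279 · support · rank 3 · open · by planner
why it might fail: No live failure mode found (see reason): believed true at every Hodge-generic G with g the deck transformation; the Lean proof is an XL named-fact assembly (monodromy density, fixed-part theorem, André), not an uncertainty.
sources: CarlsonToledo1999, arXiv:0711.2195, arXiv:1609.04165, CarlsonMullerStachPeters2017, AllcockCarlsonToledo2002, VoisinHodgeII2003
[crux] Engine (A) of the card in its first model case (the card's own fastest-refutation family):
for all n ≥ 2, d ≥ 3 there are a NON-ZERO form G(x₁,…,x_{n+1}) of degree d, a smooth projective
n-fold X cut out in ℙ^{n+1} by the cyclic equation x₀^d + G = 0 (Motives.IsHypersurfaceCutOutBy; for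
G ≠ 0 smoothness and irreducibility of X force F = x₀^d + G to be irreducible and nonsingular, so X
IS the smooth degree-d CYCLIC hypersurface — G = 0 is excluded because V₊(x₀^d)_red ≅ ℙⁿ has no
transcendental cohomology and would make the claim vacuous) and an automorphism g of X/ℂ with g^d =
1 (intended: the deck transformation x₀ ↦ ζ_d·x₀ of the cyclic covering X → ℙⁿ) such that every
endomorphism of the B-Hodge structure Hⁿ_B(X) acts on the transcendental part (classes
cup-orthogonal to all Hodge classes of Hⁿ; all of Hⁿ for n odd) as a ℚ-polynomial in g* =
B.W.pullback g n: the generic Hodge-endomorphism algebra on the cyclic locus is the image of ℚ[μ_d].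
(Rev 1, cone repair: restated over Motives.Sweep1 instead of SmoothHypersurface.hypersurface /
HodgeTheory.diagonalAut, whose import cone carries the two unproved Stein-factorisation facts;
implied by the rev-0 form for generic G — the -/
@[route_item "route-HodgeConjecture-TorelliForSymmetries", crux]
def CyclicGenericCommutant : Prop :=
  open Literature.AlgebraicGeometry.Motives CategoryTheory MonoidalCategory in ∀ B : BettiHodgeData ℂ, B.IsComparisonCompatible → (∀ ⦃n : ℕ⦄ ⦃X : SchemeOver ℂ⦄ (hX : IsSmoothProjective n X) (hXX : IsSmoothProjective (n + n) (X ⊗ X)) (i j' : ℕ) (hj : i + j' = 2 * n) (φ : HodgeStructure.Hom (B.hodge hX i) (B.hodge hX i)), ∃ u ∈ (B.hodge hXX (2 * n)).hodgeClasses (n : ℤ), B.W.IsInducedBy n n u φ.toLinearMap hj (show i + 2 * n + j' = 2 * (n + n) by omega)) → ∀ (n d : ℕ), 2 ≤ n → 3 ≤ d → ∃ G : MvPolynomial (Fin (n + 1)) ℂ, G ≠ 0 ∧ G.IsHomogeneous d ∧ ∃ (X : SchemeOver ℂ) (hX : IsSmoothProjective n X), IsHypersurfaceCutOutBy (n + 1)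 (MvPolynomial.X 0 ^ d + MvPolynomial.rename Fin.succ G) X ∧ ∃ g : X ⟶ X, End.of g ^ d = 1 ∧ ∀ φ : HodgeStructure.Hom (B.hodge hX n) (B.hodge hX n), ∃ T ∈ Submodule.span ℚ (Set.range fun k : ℕ => B.W.pullback g n ^ k), ∀ x : B.W.obj X n, (∀ (q : ℤ) (a : B.W.obj X n), 2 * q = (n : ℤ) → a ∈ (B.hodge hX n).hodgeClasses q → B.W.cup (show n + n = 2 * n by omega) x a = 0) → φ.toLinearMap x = T x

/-- item stmt-HodgeConjecture-11027 · support · rank 9 · open · by planner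
sources: Kleiman1968, VoisinHodgeI2002, Deligne2000
[support] CONSTRUCTION (interface + construction pattern; no existence is smuggled into the guarded
items): there is a Betti–Hodge realization datum B (singular cohomology of X(ℂ) with ℚ-coefficients
as a Weil cohomology, Hodge–Deligne structures, cycle classes) which is comparison-compatible with
the summit layer and satisfies the Künneth–Hodge clause (the Künneth class of a Hodge endomorphism
is a Hodge class on X × X, VoisinHodgeI2002 Lemma 11.41). Shared in substance with
ConservativityLefschetz.ClassicalBettiDatum / MomentAmplification.BettiBridge (cocycle-level guard;
equivalent by Motives/SummitCompatibleIff). [difficulty: XL] -/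
@[route_item "route-HodgeConjecture-TorelliForSymmetries", crux]
def ClassicalBettiDatum : Prop :=
  open Literature.AlgebraicGeometry.Motives CategoryTheory MonoidalCategory in ∃ B : BettiHodgeData ℂ, B.IsComparisonCompatible ∧ ∀ ⦃n : ℕ⦄ ⦃X : SchemeOver ℂ⦄ (hX : IsSmoothProjective n X) (hXX : IsSmoothProjective (n + n) (X ⊗ X)) (i j' : ℕ) (hj : i + j' = 2 * n) (φ : HodgeStructure.Hom (B.hodge hX i) (B.hodge hX i)), ∃ u ∈ (B.hodge hXX (2 * n)).hodgeClasses (n : ℤ), B.W.IsInducedBy n n u φ.toLinearMap hj (show i + 2 * n + j' = 2 * (n + n) by omega)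

/-- item stmt-HodgeConjecture-11028 · support · rank 9 · closed · proved by Summit.HodgeConjecture.HodgeConjecture.Theorems.torelliForSymmetries_reflectionsDecide_proof @ d74f4dff8474 (prover) · by planner
sources: Kleiman1968, VoisinHodgeI2002, BrosnanFangNiePearlstein2009
[support] THE REFLECTION LEMMA (new, elementary, provable now from the fields of
WeilCohomology/BettiHodgeData and the tree's HodgeStructure.Polarization): for ANY B, X smooth
projective of dimension n, p, and any polarization P of the B-Hodge structure H²ᵖ_B(X): if for every
Hodge class v the P-reflection x ↦ x − (2/P(v,v))·P(x,v)·v is induced on H²ᵖ by some class in Aⁿ(X ×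
X) ⊗ ℚ, then Hdgᵖ_B(X) = ℚ·Aᵖ_B(X). Proof: P(v,v) > 0 (Hodge–Riemann, Polarization.pos on the
(p,p)-piece); ηᵖ (hyperplane power) is algebraic and non-zero for p ≤ n (trace ηⁿ = deg > 0), H²ᵖ =
0 for p > n; correspondences preserve rational algebraic classes
(map_ratAlgebraicClasses_of_isInducedBy), so s_v(ηᵖ) = ηᵖ − (2P(ηᵖ,v)/P(v,v))v is algebraic; if
P(ηᵖ,v) ≠ 0 done, else replace v by v + ηᵖ (P(ηᵖ, v+ηᵖ) = P(ηᵖ,ηᵖ) > 0). [difficulty: provable-now] -/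
@[route_item "route-HodgeConjecture-TorelliForSymmetries", crux]
def ReflectionsDecide : Prop :=
  open Literature.AlgebraicGeometry.Motives CategoryTheory MonoidalCategory in ∀ (B : BettiHodgeData ℂ) ⦃n : ℕ⦄ ⦃X : SchemeOver ℂ⦄ (hX : IsSmoothProjective n X) (p : ℕ) (P : (B.hodge hX (2 * p)).Polarization), (∀ v ∈ (B.hodge hX (2 * p)).hodgeClasses (p : ℤ), ∀ (j' : ℕ) (hj : 2 * p + j' = 2 * n), ∃ u ∈ B.W.ratAlgebraicClasses (X ⊗ X) n, B.W.IsInducedBy n n u (LinearMap.id - (P.form.flip v).smulRight ((2 / P.form v v) • v) : B.W.obj X (2 * p) →ₗ[ℚ] B.W.obj X (2 * p)) hj (show 2 * p + 2 * n + j' = 2 * (n + n) by omega)) → B.HodgeConjectureFor hX p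

-- `ReflectionsDecide` holds: proved by `Summit.HodgeConjecture.HodgeConjecture.Theorems.torelliForSymmetries_reflectionsDecide_proof` @ d74f4dff8474 (its module imports this route file, so no `_holds` link can be stated here).

/-- item stmt-HodgeConjecture-14419 · support · rank 9 · closed · proved by Summit.HodgeConjecture.HodgeConjecture.Theorems.torelliForSymmetries_involutionsOfMiddle_proof @ e45ac31bb290 (prover) · by planner
sources: Kleiman1968, VoisinHodgeI2002
[support] GLUE concluding the target (rev 2, gate shape route.target-unreachable): ReflectionsDecide
→ MiddleInvolutions → InvolutionsAreCorrespondences. Proof (provable now, M-sized): given B guarded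
with Künneth–Hodge clause K, X smooth projective of dimension n and an involution φ of Hⁱ_B(X), K
gives a Hodge class u ∈ Hdgⁿ_B(X × X) inducing φ; X × X is smooth projective of dimension n + n
(Motives.IsSmoothProjective.tensor_holds, proved in SegreEmbedding) and H^{2n} is its middle degree;
B.polarizable hXX (2n) gives a polarization P; for every Hodge class v of H^{2n}_B(X × X) the
P-reflection s_v = id − (2/P(v,v))·P(·,v)·v is a B-Hodge endomorphism (map_F_le: P(F^a, v) = 0 for a
> n by form_apply_eq_zero since ℚv ⊆ Fⁿ, and for a ≤ n the correction lies in ℂv ⊆ Fⁿ ⊆ F^a) and s_v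
∘ s_v = id identically (also in the junk case P(v,v) = 0, where 2/0 = 0 and s_v = id);
MiddleInvolutions at Y = X × X (dimension n + n, degree 2n) makes each s_v a correspondence on (X ×
X) × (X × X); ReflectionsDecide at (B, X × X, p = n, P) yields B.HodgeConjectureFor hXX n, i.e.
ℚ·Aⁿ_B(X × X) = Hdgⁿ_B(X × X) ∋ u; finally ℚ·Aⁿ ⊆ Aⁿ ⊗ ℚ = ratAlgebraicClasses
(algebraicLattice_le_ratAlgebraicClasses + rat -/
@[route_item "route-HodgeConjecture-TorelliForSymmetries", crux]
def InvolutionsOfMiddle : Prop :=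
  ReflectionsDecide → MiddleInvolutions → InvolutionsAreCorrespondences

-- `InvolutionsOfMiddle` holds: proved by `Summit.HodgeConjecture.HodgeConjecture.Theorems.torelliForSymmetries_involutionsOfMiddle_proof` @ e45ac31bb290 (its module imports this route file, so no `_holds` link can be stated here).

/-- item stmt-HodgeConjecture-11029 · assembly · rank 1 · closed · proved by Summit.HodgeConjecture.HodgeConjecture.Theorems.torelliForSymmetries_assembly_proof @ b390d78065fb (prover) · by planner
sources: Kleiman1968, VoisinHodgeI2002, Deligne2000
[assembly] ClassicalBettiDatum → InvolutionsAreCorrespondences → HodgeConjecture (the frame "#1: X →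
Statement"; provable now modulo the reflection lemma, M-sized Lean over HodgeStructure.Polarization
and the WeilCohomology fields). -/
@[route_item "route-HodgeConjecture-TorelliForSymmetries", crux]
def Assembly : Prop :=
  ClassicalBettiDatum → InvolutionsAreCorrespondences → _root_.HodgeConjecture

-- `Assembly` holds: proved by `Summit.HodgeConjecture.HodgeConjecture.Theorems.torelliForSymmetries_assembly_proof` @ b390d78065fb (its module imports this route file, so no `_holds` link can be stated here).

/-! D-0027 §2.1 — DECIDING THEOREM (planner-authored via `route open/edit --closes-file`; by planner-rbadge-HodgeConjecture-TorelliForSymme-50d00476-0 2026-08-16T03:23:08Z):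
its hypotheses are this route's items and its conclusion the sub-problem Statement (glue_lint), and it elaborates with this file. -/

@[closes "route-HodgeConjecture-TorelliForSymmetries"] theorem closes : InvolutionsAreCorrespondences → Assembly → HypersurfaceInvolutions → CyclicGenericCommutant → SurfaceInvolutions → MiddleInvolutions → ClassicalBettiDatum → ReflectionsDecide → InvolutionsOfMiddle → _root_.HodgeConjecture :=
  fun _ h_Assembly _ _ _ h_Middle h_Datum h_Refl h_Glue => h_Assembly h_Datum (h_Glue h_Refl h_Middle)

end Summit.HodgeConjecture.HodgeConjecture.Theses.TorelliForSymmetries
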